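import Literature.Probability.Percolation.SupercriticalClusterTransience
import Mathlib.Algebra.Order.Chebyshev
import Mathlib.Topology.Algebra.InfiniteSum.Real
import HarnessLib

/-!
# Finite-energy flows from embedded trees of paths (Grimmett–Kesten–Zhang 1993, Prop. 3, flow form)

Topic `Literature/Probability/Percolation`. First (deterministic) layer of the discharge of the named
fact `GrimmettKestenZhang1993_flow` (`SupercriticalClusterTransience.lean`): the electrical half of
G. R. Grimmett, H. Kesten, Y. Zhang, *Random walk on the infinite cluster of the percolation model*,
PTRF **96** (1993) 33–44, §2, Proposition 3 — "Assume … each vertex has at least `γ` children (2.1),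
the length of `π_{K+ℓ}(r,s)` is at most `Cβ^{K+ℓ}` (2.2), each edge of `I` belongs to at most `α` of
the paths (2.3). Then the resistance between `z_K(u,v)` and infinity is at most `Σ_ℓ αCβ^{K+ℓ}/γ^ℓ`
(2.4)" — rewritten, as the fact demands, in T. Lyons' language of flows (Lyons–Peres 2016,
Thm. 2.11: transience ⟺ a unit flow of finite energy): instead of bounding a resistance we EXHIBIT
the flow whose energy Thomson's principle compares it with, namely the superposition
`f = Σ_c W_c · (unit flow along π_c)` over the children `c` of the tree, `W_c` the fraction of current
routed through `c`.

## Content (all PROVED; graph-generic: any simple graph `G` on `V`, locally finite where sums over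
neighbours are taken)

* `GKZ.walkFlow π` — the unit flow along a walk (`+1` per traversed dart, `-1` per reversed one):
  antisymmetric, supported on the edges of the walk, Kirchhoff `Σ_y walkFlow π x y = [x=a]-[x=b]`
  (`sum_walkFlow`), `|·| ≤ 1` on trails.
* `GKZ.netFlow π w` — the superposition `Σᶠ_c w_c walkFlow(π_c)`: antisymmetry, support, Kirchhoff
  (`sum_netFlow`), the pointwise Cauchy–Schwarz bound `f(x,y)² ≤ α Σ_{c ∋ {x,y}} w_c²`
  (`netFlow_sq_le`) and **finite energy** `Σ_{(x,y)} f² ≤ 2α Σ_c w_c²|π_c| < ∞`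
  (`summable_netFlow_sq`) — the computation behind (2.4).
* `GKZ.finsum_tree_netWeight` — Kirchhoff for the weights of an embedded rooted tree;
  `GKZ.tree_netFlow_spec` — the assembled statement: unit source at the root vertex, node law
  elsewhere, support on the trails' edges, finite energy.
* `GKZ.sum_add_walkFlow`, `GKZ.summable_sq_add_walkFlow` — re-rooting a unit flow along a walk
  (used with uniqueness of the infinite cluster to move the source to the origin).

Nothing probabilistic is here; the percolation estimates (GKZ Lemma 5, Lemma 6 = Grimmett 1999
Lemma (7.89), Prop. 4) and the geometry of the tree of tubes are the subsequent layers.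

## References

* G. R. Grimmett, H. Kesten, Y. Zhang, PTRF 96 (1993) 33–44, §2 Prop. 3 [GrimmettKestenZhang1993].
* R. Lyons, Y. Peres, *Probability on Trees and Networks*, CUP 2016, Thm. 2.11, §3.1 (flows from
  random paths) [LyonsPeres2016]; T. Lyons, Ann. Probab. 11 (1983) 393–402 [Lyons1983].
-/

noncomputable section

namespace Literature.Probability.Percolation

namespace GKZ

open SimpleGraph

variable {V : Type*} [DecidableEq V] {G : SimpleGraph V}

/-- The unit flow along a walk: `+1` on each dart traversed, `-1` on its reverse. [folklore] -/
def walkFlow : {a b : V} → G.Walk a b → V → V → ℝ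
  | _, _, Walk.nil => fun _ _ => 0
  | _, _, @Walk.cons _ _ a a' _ _ p => fun x y =>
      ((if x = a ∧ y = a' then 1 else 0) - (if x = a' ∧ y = a then 1 else 0)) + walkFlow p x y

/-- The empty walk carries no flow. [folklore] -/
@[simp] theorem walkFlow_nil (a : V) (x y : V) : walkFlow (Walk.nil : G.Walk a a) x y = 0 := rfl

/-- Unfolding `walkFlow` along the first dart. [folklore] -/
@[simp] theorem walkFlow_cons {a a' b : V} (h : G.Adj a a') (p : G.Walk a' b) (x y : V) :
    walkFlow (Walk.cons h p) x y =
      ((if x = a ∧ y = a' then 1 else 0) - (if x = a' ∧ y = a then 1 else 0)) + walkFlow p x y := rfl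

/-- The flow of a walk is antisymmetric. [folklore] -/
theorem walkFlow_antisymm {a b : V} (p : G.Walk a b) (x y : V) : walkFlow p x y = -walkFlow p y x := by
  induction p with
  | nil => simp
  | @cons a₀ a₁ b₁ h p ih =>
    rw [walkFlow_cons, walkFlow_cons, ih]
    have hne : a₀ ≠ a₁ := h.ne
    by_cases h1 : x = a₀ ∧ y = a₁
    · obtain ⟨rfl, rfl⟩ := h1
      simp [hne, hne.symm]; ring
    by_cases h2 : x = a₁ ∧ y = a₀
    · obtain ⟨rfl, rfl⟩ := h2
      simp [hne, hne.symm]; ring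
    · have h1' : ¬(y = a₁ ∧ x = a₀) := fun h' => h1 ⟨h'.2, h'.1⟩
      have h2' : ¬(y = a₀ ∧ x = a₁) := fun h' => h2 ⟨h'.2, h'.1⟩
      simp [h1, h2, h1', h2']

/-- A nonzero flow value sits on an edge of the walk. [folklore] -/
theorem mem_edges_of_walkFlow_ne_zero {a b : V} (p : G.Walk a b) {x y : V} (h : walkFlow p x y ≠ 0) :
    s(x, y) ∈ p.edges := by
  induction p with
  | nil => simp at h
  | @cons a₀ a₁ b₁ hadj p ih =>
    rw [Walk.edges_cons, List.mem_cons]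
    by_cases h1 : x = a₀ ∧ y = a₁
    · exact Or.inl (by rw [h1.1, h1.2])
    by_cases h2 : x = a₁ ∧ y = a₀
    · exact Or.inl (by rw [h2.1, h2.2, Sym2.eq_swap])
    right
    apply ih
    simpa [h1, h2] using h

/-- A nonzero flow value sits on an edge of the graph. [folklore] -/
theorem adj_of_walkFlow_ne_zero {a b : V} (p : G.Walk a b) {x y : V} (h : walkFlow p x y ≠ 0) :
    G.Adj x y := by
  have := p.edges_subset_edgeSet (mem_edges_of_walkFlow_ne_zero p h)
  simpa using this

/-- A nonzero flow value at `(x, y)` has `x` on the walk. [folklore] -/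
theorem fst_mem_support_of_walkFlow_ne_zero {a b : V} (p : G.Walk a b) {x y : V}
    (h : walkFlow p x y ≠ 0) : x ∈ p.support :=
  p.fst_mem_support_of_mem_edges (mem_edges_of_walkFlow_ne_zero p h)

/-- `|walkFlow p x y| ≤` the number of traversals of the edge `{x, y}`. [folklore] -/
theorem abs_walkFlow_le_count {a b : V} (p : G.Walk a b) (x y : V) :
    |walkFlow p x y| ≤ (p.edges.count s(x, y) : ℝ) := by
  induction p with
  | nil => simp
  | @cons a₀ a₁ b₁ hadj p ih =>
    rw [walkFlow_cons, Walk.edges_cons, List.count_cons]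
    push_cast
    have hne : a₀ ≠ a₁ := hadj.ne
    have hI : |((if x = a₀ ∧ y = a₁ then 1 else 0) - (if x = a₁ ∧ y = a₀ then 1 else 0) : ℝ)| ≤
        (if (s(a₀, a₁) == s(x, y)) = true then 1 else 0 : ℝ) := by
      by_cases h1 : x = a₀ ∧ y = a₁
      · obtain ⟨rfl, rfl⟩ := h1
        simp [hne, hne.symm]
      by_cases h2 : x = a₁ ∧ y = a₀
      · obtain ⟨rfl, rfl⟩ := h2
        simp [hne, hne.symm, Sym2.eq_swap]
      · simp only [h1, h2, if_false, sub_zero, abs_zero]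
        positivity
    calc |((if x = a₀ ∧ y = a₁ then 1 else 0) - (if x = a₁ ∧ y = a₀ then 1 else 0) : ℝ) + walkFlow p x y|
        ≤ |((if x = a₀ ∧ y = a₁ then 1 else 0) - (if x = a₁ ∧ y = a₀ then 1 else 0) : ℝ)| + |walkFlow p x y| :=
          abs_add_le _ _
      _ ≤ _ := by linarith

/-- On a trail (no repeated edge) the flow values are `≤ 1` in absolute value. [folklore] -/
theorem abs_walkFlow_le_one {a b : V} (p : G.Walk a b) (hp : p.edges.Nodup) (x y : V) :
    |walkFlow p x y| ≤ 1 := by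
  refine (abs_walkFlow_le_count p x y).trans ?_
  exact_mod_cast List.nodup_iff_count_le_one.1 hp _

/-- **Kirchhoff's law for a single walk**: the net out-flow at `x` is `[x = a] - [x = b]`.
[folklore] -/
theorem sum_walkFlow [G.LocallyFinite] {a b : V} (p : G.Walk a b) (x : V) :
    ∑ y ∈ G.neighborFinset x, walkFlow p x y = (if x = a then 1 else 0) - (if x = b then 1 else 0) := by
  induction p with
  | nil => simp
  | @cons a₀ a₁ b₁ hadj p ih =>
    simp only [walkFlow_cons, Finset.sum_add_distrib, Finset.sum_sub_distrib, ih]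
    have h1 : ∑ y ∈ G.neighborFinset x, (if x = a₀ ∧ y = a₁ then (1 : ℝ) else 0) = if x = a₀ then 1 else 0 := by
      by_cases hx : x = a₀
      · subst hx
        have hmem : a₁ ∈ G.neighborFinset x := by simpa using hadj
        simp [Finset.sum_ite_eq', hmem]
      · simp [hx]
    have h2 : ∑ y ∈ G.neighborFinset x, (if x = a₁ ∧ y = a₀ then (1 : ℝ) else 0) = if x = a₁ then 1 else 0 := by
      by_cases hx : x = a₁
      · subst hx
        have hmem : a₀ ∈ G.neighborFinset x := by simpa using hadj.symm
        simp [Finset.sum_ite_eq', hmem]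
      · simp [hx]
    rw [h1, h2]
    ring

/-! ### Superposition of weighted walk flows -/

section Superposition

variable {C : Type*} {u v : C → V} (π : ∀ c, G.Walk (u c) (v c)) (w : C → ℝ)

/-- The superposition `f(x,y) = Σ_c w_c · walkFlow(π_c)(x,y)` of the flows of a family of walks
(a `finsum`; meaningful when every vertex lies on finitely many of the walks). [folklore] -/
def netFlow (x y : V) : ℝ := ∑ᶠ c, w c * walkFlow (π c) x y

/-- The superposition is antisymmetric. [folklore] -/
theorem netFlow_antisymm (x y : V) : netFlow π w x y = -netFlow π w y x := by
  unfold netFlow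
  rw [← finsum_neg_distrib]
  refine finsum_congr fun c => ?_
  rw [walkFlow_antisymm (π c) x y]
  ring

/-- A nonzero value of the superposition comes from some walk. [folklore] -/
theorem exists_of_netFlow_ne_zero {x y : V} (h : netFlow π w x y ≠ 0) :
    ∃ c, walkFlow (π c) x y ≠ 0 := by
  by_contra hc
  push Not at hc
  exact h (finsum_eq_zero_of_forall_eq_zero fun c => by rw [hc c, mul_zero])

/-- The superposition is supported on edges of `G`. [folklore] -/
theorem adj_of_netFlow_ne_zero {x y : V} (h : netFlow π w x y ≠ 0) : G.Adj x y := by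
  obtain ⟨c, hc⟩ := exists_of_netFlow_ne_zero π w h
  exact adj_of_walkFlow_ne_zero (π c) hc

/-- The superposition is supported on the edges of the walks. [folklore] -/
theorem exists_mem_edges_of_netFlow_ne_zero {x y : V} (h : netFlow π w x y ≠ 0) :
    ∃ c, s(x, y) ∈ (π c).edges := by
  obtain ⟨c, hc⟩ := exists_of_netFlow_ne_zero π w h
  exact ⟨c, mem_edges_of_walkFlow_ne_zero (π c) hc⟩

variable (hfin : ∀ x : V, {c | x ∈ (π c).support}.Finite)
include hfin

/-- Only walks through `x` contribute at `(x, y)`. [folklore] -/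
theorem support_subset_toFinset (x y : V) :
    (Function.support fun c => w c * walkFlow (π c) x y) ⊆ ↑(hfin x).toFinset := by
  intro c hc
  rw [Function.mem_support] at hc
  simp only [Set.Finite.coe_toFinset, Set.mem_setOf_eq]
  exact fst_mem_support_of_walkFlow_ne_zero (π c) (right_ne_zero_of_mul hc)

/-- The `finsum` is a finite sum over the walks through `x`. [folklore] -/
theorem netFlow_eq_sum (x y : V) :
    netFlow π w x y = ∑ c ∈ (hfin x).toFinset, w c * walkFlow (π c) x y :=
  finsum_eq_finsetSum_of_support_subset _ (support_subset_toFinset π w hfin x y)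

/-- **Kirchhoff's law for the superposition**: the net out-flow at `x` is the weighted count of
walks starting at `x` minus those ending at `x`. [folklore] -/
theorem sum_netFlow [G.LocallyFinite] (x : V) :
    ∑ y ∈ G.neighborFinset x, netFlow π w x y =
      ∑ᶠ c, w c * ((if x = u c then 1 else 0) - (if x = v c then 1 else 0)) := by
  simp_rw [netFlow_eq_sum π w hfin]
  rw [Finset.sum_comm]
  have hsupp : (Function.support fun c => w c * ((if x = u c then (1 : ℝ) else 0) - (if x = v c then 1 else 0)))
      ⊆ ↑(hfin x).toFinset := by
    intro c hc
    rw [Function.mem_support] at hc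
    have hc' := right_ne_zero_of_mul hc
    simp only [Set.Finite.coe_toFinset, Set.mem_setOf_eq]
    by_cases hu : x = u c
    · rw [hu]; exact (π c).start_mem_support
    by_cases hv : x = v c
    · rw [hv]; exact (π c).end_mem_support
    · simp [hu, hv] at hc'
  rw [finsum_eq_finsetSum_of_support_subset _ hsupp]
  refine Finset.sum_congr rfl fun c _ => ?_
  rw [← Finset.mul_sum, sum_walkFlow]

/-- The finite set of walks through the edge `{x, y}`. [folklore] -/
def edgeUsers (x y : V) : Finset C := (hfin x).toFinset.filter fun c => s(x, y) ∈ (π c).edges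

/-- Membership in `edgeUsers`. [folklore] -/
theorem mem_edgeUsers {x y : V} {c : C} : c ∈ edgeUsers π hfin x y ↔ s(x, y) ∈ (π c).edges := by
  unfold edgeUsers
  simp only [Finset.mem_filter, Set.Finite.mem_toFinset, Set.mem_setOf_eq, and_iff_right_iff_imp]
  exact fun h => (π c).fst_mem_support_of_mem_edges h

/-- The superposition at `(x, y)` is a sum over the walks through `{x, y}`. [folklore] -/
theorem netFlow_eq_sum_edgeUsers (x y : V) :
    netFlow π w x y = ∑ c ∈ edgeUsers π hfin x y, w c * walkFlow (π c) x y := by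
  rw [netFlow_eq_sum π w hfin, edgeUsers, Finset.sum_filter_of_ne]
  intro c _ hc
  exact mem_edges_of_walkFlow_ne_zero (π c) (right_ne_zero_of_mul hc)

/-- **Pointwise energy bound**: with trails of edge-multiplicity `≤ α`,
`f(x,y)² ≤ α Σ_{c ∋ {x,y}} w_c²` (Cauchy–Schwarz). [cite: GrimmettKestenZhang1993, Prop. 3 (proof)] -/
theorem netFlow_sq_le (htrail : ∀ c, (π c).edges.Nodup) (α : ℕ)
    (hmult : ∀ x y : V, {c | s(x, y) ∈ (π c).edges}.ncard ≤ α) (x y : V) :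
    netFlow π w x y ^ 2 ≤ α * ∑ c ∈ edgeUsers π hfin x y, w c ^ 2 := by
  rw [netFlow_eq_sum_edgeUsers π w hfin]
  have h1 : |∑ c ∈ edgeUsers π hfin x y, w c * walkFlow (π c) x y| ≤ ∑ c ∈ edgeUsers π hfin x y, |w c| := by
    refine (Finset.abs_sum_le_sum_abs _ _).trans (Finset.sum_le_sum fun c _ => ?_)
    rw [abs_mul]
    exact mul_le_of_le_one_right (abs_nonneg _) (abs_walkFlow_le_one (π c) (htrail c) x y)
  have h2 : (∑ c ∈ edgeUsers π hfin x y, w c * walkFlow (π c) x y) ^ 2 ≤ (∑ c ∈ edgeUsers π hfin x y, |w c|) ^ 2 := by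
    rw [← sq_abs]
    exact pow_le_pow_left₀ (abs_nonneg _) h1 2
  have h3 := sq_sum_le_card_mul_sum_sq (s := edgeUsers π hfin x y) (f := fun c => |w c|)
  have hcard : ((edgeUsers π hfin x y).card : ℝ) ≤ α := by
    have hfin' : {c | s(x, y) ∈ (π c).edges}.Finite :=
      (hfin x).subset fun c hc => (π c).fst_mem_support_of_mem_edges hc
    have : (edgeUsers π hfin x y).card ≤ {c | s(x, y) ∈ (π c).edges}.ncard := by
      rw [← Set.ncard_coe_finset]
      exact Set.ncard_le_ncard (fun c hc => (mem_edgeUsers π hfin).1 hc) hfin'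
    exact_mod_cast this.trans (hmult x y)
  have h4 : (0 : ℝ) ≤ ∑ c ∈ edgeUsers π hfin x y, |w c| ^ 2 := Finset.sum_nonneg fun c _ => by positivity
  calc (∑ c ∈ edgeUsers π hfin x y, w c * walkFlow (π c) x y) ^ 2
      ≤ (∑ c ∈ edgeUsers π hfin x y, |w c|) ^ 2 := h2
    _ ≤ (edgeUsers π hfin x y).card * ∑ c ∈ edgeUsers π hfin x y, |w c| ^ 2 := h3
    _ ≤ α * ∑ c ∈ edgeUsers π hfin x y, |w c| ^ 2 := mul_le_mul_of_nonneg_right hcard h4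
    _ = α * ∑ c ∈ edgeUsers π hfin x y, w c ^ 2 := by simp [sq_abs]

omit hfin in
/-- A walk of length `n` uses at most `2n` ordered pairs `(x, y)` with `{x, y}` an edge. [folklore] -/
theorem card_filter_mem_edges_le (c : C) (s : Finset (V × V)) :
    ((s.filter fun q => s(q.1, q.2) ∈ (π c).edges).card : ℝ) ≤ 2 * (π c).length := by
  classical
  set D : Finset (V × V) :=
    ((π c).darts.map Dart.toProd ++ (π c).darts.map (Prod.swap ∘ Dart.toProd)).toFinset with hD
  have hsub : (s.filter fun q => s(q.1, q.2) ∈ (π c).edges) ⊆ D := by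
    intro q hq
    rw [Finset.mem_filter] at hq
    obtain ⟨d, hd, hde⟩ := List.mem_map.1 hq.2
    rw [hD, List.mem_toFinset, List.mem_append, List.mem_map, List.mem_map]
    rcases dart_edge_eq_mk'_iff.1 hde with h | h
    · exact Or.inl ⟨d, hd, h⟩
    · exact Or.inr ⟨d, hd, by simp [h]⟩
  have hcard : D.card ≤ 2 * (π c).length := by
    refine (List.toFinset_card_le _).trans ?_
    simp [two_mul]
  exact_mod_cast (Finset.card_le_card hsub).trans hcard

/-- **The energy is finite**: if `Σ_c w_c² |π_c| < ∞` then `Σ_{(x,y)} f(x,y)² < ∞`.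
[cite: GrimmettKestenZhang1993, Prop. 3 (2.4)] -/
theorem summable_netFlow_sq (htrail : ∀ c, (π c).edges.Nodup) (α : ℕ)
    (hmult : ∀ x y : V, {c | s(x, y) ∈ (π c).edges}.ncard ≤ α)
    (hw : Summable fun c => w c ^ 2 * (π c).length) :
    Summable fun q : V × V => netFlow π w q.1 q.2 ^ 2 := by
  classical
  -- the dominating function
  set g : V × V → ℝ := fun q => ∑ c ∈ edgeUsers π hfin q.1 q.2, w c ^ 2 with hg
  have hg0 : 0 ≤ g := fun q => Finset.sum_nonneg fun c _ => sq_nonneg _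
  have hgs : Summable g := by
    refine summable_of_sum_le hg0 (c := 2 * ∑' c, w c ^ 2 * (π c).length) fun s => ?_
    set T : Finset C := s.biUnion fun q => edgeUsers π hfin q.1 q.2 with hT
    have hstep : ∀ q ∈ s, g q = ∑ c ∈ T, if c ∈ edgeUsers π hfin q.1 q.2 then w c ^ 2 else 0 := by
      intro q hq
      rw [hg, Finset.sum_ite_mem]
      show ∑ c ∈ edgeUsers π hfin q.1 q.2, w c ^ 2 = ∑ i ∈ T ∩ edgeUsers π hfin q.1 q.2, w i ^ 2
      rw [Finset.inter_eq_right.2 (Finset.subset_biUnion_of_mem (fun q => edgeUsers π hfin q.1 q.2) hq)]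
    rw [Finset.sum_congr rfl hstep, Finset.sum_comm]
    have hinner : ∀ c ∈ T, ∑ q ∈ s, (if c ∈ edgeUsers π hfin q.1 q.2 then w c ^ 2 else 0) ≤
        2 * (w c ^ 2 * (π c).length) := by
      intro c _
      rw [← Finset.sum_filter, Finset.sum_const, nsmul_eq_mul]
      have hc := card_filter_mem_edges_le π c s
      have hfilt : (s.filter fun q => c ∈ edgeUsers π hfin q.1 q.2) = s.filter fun q => s(q.1, q.2) ∈ (π c).edges := by
        refine Finset.filter_congr fun q _ => ?_
        exact mem_edgeUsers π hfin
      rw [hfilt]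
      nlinarith [sq_nonneg (w c)]
    calc ∑ c ∈ T, ∑ q ∈ s, (if c ∈ edgeUsers π hfin q.1 q.2 then w c ^ 2 else 0)
        ≤ ∑ c ∈ T, 2 * (w c ^ 2 * (π c).length) := Finset.sum_le_sum hinner
      _ = 2 * ∑ c ∈ T, w c ^ 2 * (π c).length := by rw [Finset.mul_sum]
      _ ≤ 2 * ∑' c, w c ^ 2 * (π c).length := by
          refine mul_le_mul_of_nonneg_left (hw.sum_le_tsum T fun c _ => by positivity) (by norm_num)
  refine Summable.of_nonneg_of_le (fun q => sq_nonneg _) (fun q => ?_) (hgs.mul_left (α : ℝ))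
  exact netFlow_sq_le π w hfin htrail α hmult q.1 q.2

end Superposition

/-! ### Tree weights: Kirchhoff's law for a weighted rooted tree embedded in `V` -/

section Tree

variable {N : Type*} [DecidableEq N] (z : N → V) (r : N) (par : N → N) (W : N → ℝ)

/-- **Kirchhoff for tree weights.** If every node's weight is the total weight of its children
(finitely many), the root has weight `1`, and the nodes sit at distinct vertices, then the family
"child `c` carries `W c` from `z (par c)` to `z c`" has net out-flow `[x = z r]` at every vertex.
[cite: GrimmettKestenZhang1993, Prop. 3 (proof: the tree T̃)] -/
theorem finsum_tree_netWeight (hz : Function.Injective z) (hr : W r = 1)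
    (hfin : ∀ n, {c : {n : N // n ≠ r} | par c = n}.Finite)
    (hW : ∀ n, ∑ᶠ c : {n : N // n ≠ r}, (if par c = n then W c else 0) = W n) (x : V) :
    ∑ᶠ c : {n : N // n ≠ r}, W c * ((if x = z (par c) then 1 else 0) - (if x = z c then 1 else 0)) =
      if x = z r then 1 else 0 := by
  classical
  by_cases hx : ∃ n, x = z n
  swap
  · push Not at hx
    rw [if_neg (hx r)]
    exact finsum_eq_zero_of_forall_eq_zero fun c => by simp [hx (par c), hx c]
  obtain ⟨n₀, rfl⟩ := hx
  have hsummand : ∀ c : {n : N // n ≠ r},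
      W c * ((if z n₀ = z (par c) then (1 : ℝ) else 0) - (if z n₀ = z c then 1 else 0)) =
        (if par c = n₀ then W c else 0) - (if (c : N) = n₀ then W c else 0) := by
    intro c
    have e1 : (z n₀ = z (par c)) ↔ (par c = n₀) := by rw [hz.eq_iff, eq_comm]
    have e2 : (z n₀ = z c) ↔ ((c : N) = n₀) := by rw [hz.eq_iff, eq_comm]
    by_cases h1 : par c = n₀ <;> by_cases h2 : (c : N) = n₀
    · rw [if_pos (e1.2 h1), if_pos (e2.2 h2), if_pos h1, if_pos h2]; ring
    · rw [if_pos (e1.2 h1), if_neg (mt e2.1 h2), if_pos h1, if_neg h2]; ring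
    · rw [if_neg (mt e1.1 h1), if_pos (e2.2 h2), if_neg h1, if_pos h2]; ring
    · rw [if_neg (mt e1.1 h1), if_neg (mt e2.1 h2), if_neg h1, if_neg h2]; ring
  simp_rw [hsummand]
  have hf1 : (Function.support fun c : {n : N // n ≠ r} => if par c = n₀ then W c else 0).Finite := by
    refine (hfin n₀).subset fun c hc => ?_
    rw [Function.mem_support] at hc
    by_contra h
    exact hc (if_neg h)
  have hf2 : (Function.support fun c : {n : N // n ≠ r} => if (c : N) = n₀ then W c else 0).Finite := by
    refine ((Set.finite_singleton n₀).preimage Subtype.val_injective.injOn).subset fun c hc => ?_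
    rw [Function.mem_support] at hc
    by_contra h
    exact hc (if_neg (by simpa using h))
  rw [finsum_sub_distrib hf1 hf2, hW n₀]
  by_cases hn : n₀ = r
  · subst hn
    rw [if_pos rfl, hr, finsum_eq_zero_of_forall_eq_zero fun c => if_neg c.2, sub_zero]
  · rw [if_neg (fun h => hn (hz h)), finsum_eq_single _ (⟨n₀, hn⟩ : {n : N // n ≠ r})]
    · simp
    · intro c hc
      exact if_neg fun h => hc (Subtype.ext h)

end Tree

/-! ### Moving the source along an open path -/

section Surgery

/-- The flow of a single walk has finite support (pairs along its darts). [folklore] -/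
theorem hasFiniteSupport_walkFlow {a b : V} (p : G.Walk a b) :
    (Function.support fun q : V × V => walkFlow p q.1 q.2).Finite := by
  classical
  set D : Finset (V × V) :=
    (p.darts.map Dart.toProd ++ p.darts.map (Prod.swap ∘ Dart.toProd)).toFinset with hD
  refine D.finite_toSet.subset fun q hq => ?_
  rw [Function.mem_support] at hq
  have he := mem_edges_of_walkFlow_ne_zero p hq
  obtain ⟨d, hd, hde⟩ := List.mem_map.1 he
  simp only [hD, Finset.mem_coe, List.mem_toFinset, List.mem_append, List.mem_map]
  rcases dart_edge_eq_mk'_iff.1 hde with h | h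
  · exact Or.inl ⟨d, hd, h⟩
  · exact Or.inr ⟨d, hd, by simp [h]⟩

variable [G.LocallyFinite]

/-- **Re-rooting a unit flow**: if `f` is a unit flow out of `o'` and `γ` is a walk from `o` to
`o'`, then `f + walkFlow γ` is a unit flow out of `o`. [cite: LyonsPeres2016, §2.4 (Thm. 2.11: "from some (every) vertex")] -/
theorem sum_add_walkFlow {o o' : V} {f : V → V → ℝ}
    (hf : ∀ x, ∑ y ∈ G.neighborFinset x, f x y = if x = o' then 1 else 0) (γ : G.Walk o o') (x : V) :
    ∑ y ∈ G.neighborFinset x, (f x y + walkFlow γ x y) = if x = o then 1 else 0 := by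
  rw [Finset.sum_add_distrib, hf x, sum_walkFlow]
  ring

omit [G.LocallyFinite] in
/-- The re-rooted flow still has finite energy. [folklore] -/
theorem summable_sq_add_walkFlow {a b : V} {f : V → V → ℝ}
    (hf : Summable fun q : V × V => f q.1 q.2 ^ 2) (γ : G.Walk a b) :
    Summable fun q : V × V => (f q.1 q.2 + walkFlow γ q.1 q.2) ^ 2 := by
  have hγ : Summable fun q : V × V => walkFlow γ q.1 q.2 ^ 2 := by
    refine summable_of_hasFiniteSupport ((hasFiniteSupport_walkFlow γ).subset fun q hq => ?_)
    rw [Function.mem_support] at hq ⊢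
    exact fun h => hq (by rw [h]; ring)
  refine Summable.of_nonneg_of_le (fun q => sq_nonneg _) (fun q => ?_) ((hf.mul_left 2).add (hγ.mul_left 2))
  nlinarith [sq_nonneg (f q.1 q.2 - walkFlow γ q.1 q.2)]

end Surgery

/-! ### Assembly: the flow of an embedded weighted tree of trails -/

/-- **GKZ Proposition 3 in flow form.** An embedded rooted tree (`z` injective, root weight `1`,
each node's weight split among its finitely many children), each child joined to its parent by
a trail `π_c` of `G`, every vertex on finitely many trails, every edge on at most `α` trails, and
`Σ_c W_c² |π_c| < ∞`: then `f = Σ_c W_c · walkFlow(π_c)` is an antisymmetric function supported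
on the edges of the trails, satisfying Kirchhoff's node law with a unit source at the root
vertex, of finite energy `Σ f² < ∞`. (Prop. 3 bounds the effective resistance of the "almost
tree" by `Σ_ℓ α C β^{K+ℓ}/γ^ℓ`; by Thomson's principle this is the energy of exactly this flow.)
[cite: GrimmettKestenZhang1993, Prop. 3 and (2.4)] [cite: LyonsPeres2016, Thm. 2.11] -/
theorem tree_netFlow_spec [G.LocallyFinite] {N : Type*} [DecidableEq N] (z : N → V) (r : N)
    (par : N → N) (W : N → ℝ) (hz : Function.Injective z) (hr : W r = 1)
    (hfinpar : ∀ n, {c : {n : N // n ≠ r} | par c = n}.Finite)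
    (hW : ∀ n, ∑ᶠ c : {n : N // n ≠ r}, (if par c = n then W c else 0) = W n)
    (π : ∀ c : {n : N // n ≠ r}, G.Walk (z (par c)) (z c))
    (hfin : ∀ x : V, {c | x ∈ (π c).support}.Finite) (htrail : ∀ c, (π c).edges.Nodup)
    (α : ℕ) (hmult : ∀ x y : V, {c | s(x, y) ∈ (π c).edges}.ncard ≤ α)
    (hw : Summable fun c : {n : N // n ≠ r} => W c ^ 2 * (π c).length) :
    (∀ x y, netFlow π (fun c => W c) x y = -netFlow π (fun c => W c) y x) ∧
    (∀ x y, netFlow π (fun c => W c) x y ≠ 0 → G.Adj x y ∧ ∃ c, s(x, y) ∈ (π c).edges) ∧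
    (∀ x, ∑ y ∈ G.neighborFinset x, netFlow π (fun c => W c) x y = if x = z r then 1 else 0) ∧
    Summable fun q : V × V => netFlow π (fun c => W c) q.1 q.2 ^ 2 := by
  refine ⟨netFlow_antisymm π _, fun x y h => ⟨adj_of_netFlow_ne_zero π _ h,
    exists_mem_edges_of_netFlow_ne_zero π _ h⟩, fun x => ?_,
    summable_netFlow_sq π _ hfin htrail α hmult hw⟩
  rw [sum_netFlow π _ hfin x]
  exact finsum_tree_netWeight z r par W hz hr hfinpar hW x

end GKZ

end Literature.Probability.Percolation
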